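import Literature.NumberTheory.LFunctions.RosserSchoenfeldEq327
import Literature.NumberTheory.LFunctions.MertensThirdUpperBound
import HarnessLib

/-!
# RH-FREE kernel certificate — «nothing here bears on the truth of RH»
# Rosser–Schoenfeld's Corollary (3.30): `∏_{p ≤ x} p/(p − 1) < e^γ log x · (1 + 1/log² x)` for EVERY real `x > 1`
# (below `286` by a direct kernel certificate; beyond from (3.29))

Topic: `Literature/NumberTheory/LFunctions`. Pure proof file (theorems only; no definition, no named fact).
Rosser–Schoenfeld's Theorem 8 gives (3.29) (factor `1 + 1/(2 log² x)`) only for `x ≥ 286`; the Corollary (3.30) trades the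
constant `1/2` for the full range `x > 1`. The tree has (3.29) UNCONDITIONALLY on `[286, 3 659 203)`
(`RosserSchoenfeld1962_eq_3_29_of_lt_3659203`, kernel certificate) and for `x ≥ 3 594 641` from Dusart's `θ`-fact
(`RosserSchoenfeld1962_eq_3_29_of_dusart`), hence the (3.30) shape on `x ≥ 286`
(`RosserSchoenfeld1962_eq_3_30_of_ge_286_holds_of`, `MertensThirdUpperBound.lean`). This file supplies `1 < x < 286`, prime
gap by prime gap, re-using the per-prime chain states already certified in the tree: with
`Σ(p) = Σ_{q ≤ p} log(q/(q−1))`, majorised by `(Ahi + S + (L2HIN − 2⁷⁹))/2⁸⁰` from the accumulation-chain states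
`RosserSchoenfeldEq327.invA_p` and the upper-chain states `RosserSchoenfeldEq320.inv_p` (`RosserSchoenfeldEq327.sum_log_inv_le`),
(3.30) on `[p, p')` reads `Σ(p) < γ + log L + log(1 + 1/L²)`, `L = log x`; the right side is `γ + log(L + 1/L)`, increasing
in `L ≥ 1` (`log_add_log_one_add_inv_sq_mono`), so it suffices to compare at `x = p` (`p ≥ 3 > e`), where
`log log p ≥ LL_p/2⁸⁰` and `log(1 + 1/log² p) ≥ log(1 + u) ≥ u − u²/2 + u³/3 − u⁴/4 + u⁵/5 − u⁶/6 − u⁷/(1 − u)` for any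
dyadic `u = k/2²⁰ ≤ 2¹⁶⁰/Lhi_p² ≤ 1/log² p` (`Real.abs_log_sub_add_sum_range_le` with six terms; the margins are
`3.4·10⁻⁴` at `p = 19` and `1.3·10⁻³` at `p = 7`, all others `> 6·10⁻³`). The comparisons are exact (`norm_num`).
Below `5` the product is `≤ 3 < 2e^γ ≤ e^γ (L + 1/L)`. Whence
**`RosserSchoenfeld1962_eq_3_30_of_lt_286`** and **`RosserSchoenfeld1962_eq_3_30_of_lt_3659203`** (unconditional) and
**`RosserSchoenfeld1962_eq_3_30_holds_of : Dusart2010_theta_thm_5_2 → ∀ x > 1, ∏_{p ≤ x} p/(p − 1) < e^γ log x · (1 + 1/log² x)`**,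
and Theorem 8 with both corollary ranges (`RosserSchoenfeld1962_thm8_cor_holds_of`).
Standard axioms (no `decide` beyond `norm_num`/`interval_cases`; no `native_decide`). Nothing here concerns RH.

## References
* J. B. Rosser, L. Schoenfeld, Illinois J. Math. 6 (1962), 64–94: Thm 8 Cor. (3.30), p. 70; §8 p. 87. [RosserSchoenfeld1962]
* P. Dusart, arXiv:1002.0442 (2010), Thm 5.2 (`k = 2`). [Dusart2010]
-/

noncomputable section

namespace Literature.NumberTheory.LFunctions

open Mertens MertensSecondChain ChainCheck
open Literature.Analysis.SpecialFunctions

namespace RosserSchoenfeldEq330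

/-! ### Real-analysis helpers -/

/-- `L ↦ log L + log(1 + 1/L²) = log(L + 1/L)` is monotone on `[1, ∞)`. [cite: RosserSchoenfeld1962, Thm. 8 Cor. (3.30) (shape of the bound)] -/
theorem log_add_log_one_add_inv_sq_mono {a b : ℝ} (ha : 1 ≤ a) (hab : a ≤ b) :
    Real.log a + Real.log (1 + 1 / a ^ 2) ≤ Real.log b + Real.log (1 + 1 / b ^ 2) := by
  have ha0 : 0 < a := by linarith
  have hb0 : 0 < b := by linarith
  rw [← Real.log_mul ha0.ne' (by positivity), ← Real.log_mul hb0.ne' (by positivity)]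
  apply Real.log_le_log (by positivity)
  have e1 : a * (1 + 1 / a ^ 2) = a + 1 / a := by field_simp
  have e2 : b * (1 + 1 / b ^ 2) = b + 1 / b := by field_simp
  rw [e1, e2]
  have hab1 : 1 ≤ a * b := by nlinarith
  have e3 : b + 1 / b - (a + 1 / a) = (b - a) * (a * b - 1) / (a * b) := by field_simp; ring
  have h3 : 0 ≤ (b - a) * (a * b - 1) / (a * b) := by
    apply div_nonneg (mul_nonneg (by linarith) (by linarith)) (by positivity)
  linarith

/-- Six-term lower bound `log(1 + u) ≥ u − u²/2 + u³/3 − u⁴/4 + u⁵/5 − u⁶/6 − u⁷/(1 − u)` for `0 ≤ u < 1`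
(`Real.abs_log_sub_add_sum_range_le` at `x = −u`, `n = 6`). [folklore] -/
private theorem log_one_add_ge_six {u : ℝ} (hu0 : 0 ≤ u) (hu1 : u < 1) :
    u - u ^ 2 / 2 + u ^ 3 / 3 - u ^ 4 / 4 + u ^ 5 / 5 - u ^ 6 / 6 - u ^ 7 / (1 - u) ≤ Real.log (1 + u) := by
  have h := Real.abs_log_sub_add_sum_range_le (x := -u) (by rw [abs_neg, abs_of_nonneg hu0]; exact hu1) 6
  rw [abs_neg, abs_of_nonneg hu0, sub_neg_eq_add] at h
  have h1 := (abs_le.1 h).1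
  have e : (∑ i ∈ Finset.range 6, (-u) ^ (i + 1) / ((i : ℝ) + 1)) =
      -(u - u ^ 2 / 2 + u ^ 3 / 3 - u ^ 4 / 4 + u ^ 5 / 5 - u ^ 6 / 6) := by
    simp only [Finset.sum_range_succ, Finset.sum_range_zero, Nat.cast_zero, Nat.cast_one, Nat.cast_ofNat]
    ring
  rw [e] at h1
  have e7 : u ^ (6 + 1) = u ^ 7 := by norm_num
  rw [e7] at h1
  linarith

/-- The right side of (3.30) in exponential form: `e^γ · L · (1 + 1/L²) = exp(γ + log L + log(1 + 1/L²))` for `L > 0`.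
[folklore] -/
private theorem rhs_eq {L : ℝ} (hL : 0 < L) :
    Real.exp Real.eulerMascheroniConstant * L * (1 + 1 / L ^ 2) =
      Real.exp (Real.eulerMascheroniConstant + Real.log L + Real.log (1 + 1 / L ^ 2)) := by
  rw [Real.exp_add, Real.exp_add, Real.exp_log hL, Real.exp_log (by positivity)]

/-- `2 e^γ ≤ e^γ · L · (1 + 1/L²)` for `L > 0` (`L + 1/L ≥ 2`), and `3 < 2 e^γ` (`γ > 1/2`, `e^{1/2} > 1.6`):
the right side of (3.30) exceeds `3` for every `x > 1`. [folklore] -/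
private theorem three_lt_rhs {x : ℝ} (hx : 1 < x) :
    (3 : ℝ) < Real.exp Real.eulerMascheroniConstant * Real.log x * (1 + 1 / Real.log x ^ 2) := by
  set L := Real.log x with hL
  have hL0 : 0 < L := Real.log_pos hx
  have e1 : Real.exp Real.eulerMascheroniConstant * L * (1 + 1 / L ^ 2) =
      Real.exp Real.eulerMascheroniConstant * (L + 1 / L) := by
    field_simp
  rw [e1]
  have h2 : 2 ≤ L + 1 / L := by
    rw [show L + 1 / L = (L ^ 2 + 1) / L by field_simp, le_div_iff₀ hL0]
    nlinarith [sq_nonneg (L - 1)]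
  have hγ := Real.eulerMascheroniConstant_gt_d8
  -- `exp γ > exp(1/2) ≥ 1 + 1/2 + 1/8 > 3/2`
  have h3 : (3 / 2 : ℝ) < Real.exp Real.eulerMascheroniConstant := by
    have h4 : Real.exp (1 / 2) < Real.exp Real.eulerMascheroniConstant := Real.exp_lt_exp.2 (by linarith)
    have h5 : (1 : ℝ) + 1 / 2 ≤ Real.exp (1 / 2) := by
      have := Real.add_one_le_exp (1 / 2 : ℝ)
      linarith
    linarith
  nlinarith [Real.exp_pos Real.eulerMascheroniConstant]

/-! ### The gap lemma -/

/-- **(3.30) on a prime gap `[p, p')`, `p ≥ 3`**: from the accumulation-chain and upper-chain states at `p`, no prime in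
`(p, p')`, a dyadic `u = k/2²⁰` with `k·Lhi² ≤ 2¹⁸⁰` (so `u ≤ 1/log² p`), and the exact comparison
`Ahi + S + (L2HIN − 2⁷⁹) < 2⁸⁰·0.57721558 + LL + 2⁸⁰·(u − u²/2 + u³/3 − u⁴/4 + u⁵/5 − u⁶/6 − u⁷/(1 − u))`.
[cite: RosserSchoenfeld1962, Thm. 8 Cor. (3.30), p. 70] -/
theorem eq_3_30_on_gap {p A Ahi Llo Lhi LL S : ℕ} (hA : InvA ⟨p, A, Ahi⟩)
    (hU : MertensSecondUpperChain.Inv ⟨p, Llo, Lhi, LL, S⟩) {p' : ℕ}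
    (hq : ∀ q : ℕ, p < q → q < p' → ¬ q.Prime) (k : ℕ)
    (hk : (k : ℝ) * ((Lhi : ℝ) * Lhi) ≤ 2 ^ 180)
    (hcmp : (Ahi : ℝ) + S + (837963523372001241347433 - 2 ^ 79) <
      2 ^ 80 * 0.57721558 + LL + 2 ^ 80 *
        ((k : ℝ) / 2 ^ 20 - ((k : ℝ) / 2 ^ 20) ^ 2 / 2 + ((k : ℝ) / 2 ^ 20) ^ 3 / 3 - ((k : ℝ) / 2 ^ 20) ^ 4 / 4
          + ((k : ℝ) / 2 ^ 20) ^ 5 / 5 - ((k : ℝ) / 2 ^ 20) ^ 6 / 6 - ((k : ℝ) / 2 ^ 20) ^ 7 / (1 - (k : ℝ) / 2 ^ 20)))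
    {x : ℝ} (hpx : (p : ℝ) ≤ x) (hxp : x < p') :
    ∏ q ∈ Nat.primesLE ⌊x⌋₊, (q : ℝ) / ((q : ℝ) - 1) <
      Real.exp Real.eulerMascheroniConstant * Real.log x * (1 + 1 / Real.log x ^ 2) := by
  have hSig := RosserSchoenfeldEq327.sum_log_inv_le hA hU
  obtain ⟨-, -, h3, -, hLhi, hLL, -, -⟩ := hU
  simp only at h3 hLhi hLL
  have h80 : (0 : ℝ) < 2 ^ 80 := by positivity
  have hp3 : (3 : ℝ) ≤ p := by exact_mod_cast h3
  have hx0 : 0 ≤ x := by linarith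
  -- `log p > 1` (`p ≥ 3 > e`)
  have hlp : 1 < Real.log (p : ℝ) := by
    rw [Real.lt_log_iff_exp_lt (by linarith)]
    have := Real.exp_one_lt_d9
    linarith
  have hlp0 : 0 < Real.log (p : ℝ) := by linarith
  have hlpx : Real.log (p : ℝ) ≤ Real.log x := Real.log_le_log (by linarith) hpx
  have hL0 : 0 < Real.log x := by linarith
  -- the product over `primesLE ⌊x⌋₊` is `exp Σ(p)`
  have hfl1 : p ≤ ⌊x⌋₊ := Nat.le_floor hpx
  have hfl2 : ⌊x⌋₊ < p' := (Nat.floor_lt hx0).2 hxp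
  rw [prod_div_pred_eq_exp_sumLog, MertensChain.sum_primesLE_eq_of_noPrime
      (fun q : ℕ => Real.log ((1 - (q : ℝ)⁻¹)⁻¹)) hfl1 (fun q h1 h2 => hq q h1 (by omega)), rhs_eq hL0]
  apply Real.exp_lt_exp.2
  -- it remains: `Σ(p) < γ + log log x + log(1 + 1/log² x)`; compare at `x = p`
  have hmono := log_add_log_one_add_inv_sq_mono hlp.le hlpx
  have hγ := Real.eulerMascheroniConstant_gt_d8
  -- `u ≤ 1/log² p < 1`
  set u : ℝ := (k : ℝ) / 2 ^ 20 with hu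
  have hLhi0 : (0 : ℝ) < Lhi := by
    have : (0 : ℝ) < 2 ^ 80 * Real.log p := mul_pos h80 hlp0
    linarith
  have hu0 : 0 ≤ u := by rw [hu]; positivity
  have hu_le : u ≤ 1 / Real.log (p : ℝ) ^ 2 := by
    rw [le_div_iff₀ (by positivity)]
    have h1 : u * ((Lhi : ℝ) * Lhi) ≤ 2 ^ 160 := by
      rw [hu, div_mul_eq_mul_div, div_le_iff₀ (by positivity)]
      have e : (2 : ℝ) ^ 160 * 2 ^ 20 = 2 ^ 180 := by norm_num
      rw [e]; exact hk
    have h2 : (2 : ℝ) ^ 80 * Real.log p * (2 ^ 80 * Real.log p) ≤ (Lhi : ℝ) * Lhi :=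
      mul_le_mul hLhi hLhi (by positivity) hLhi0.le
    have h3 : u * (2 ^ 80 * Real.log p * (2 ^ 80 * Real.log p)) ≤ 2 ^ 160 :=
      le_trans (mul_le_mul_of_nonneg_left h2 hu0) h1
    nlinarith
  have hip1 : 1 / Real.log (p : ℝ) ^ 2 < 1 := by rw [div_lt_one (by positivity)]; nlinarith
  have hu1 : u < 1 := lt_of_le_of_lt hu_le hip1
  have hser := log_one_add_ge_six hu0 hu1
  have hlogu : Real.log (1 + u) ≤ Real.log (1 + 1 / Real.log (p : ℝ) ^ 2) :=
    Real.log_le_log (by linarith) (by linarith)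
  have hLL' : (LL : ℝ) / 2 ^ 80 ≤ Real.log (Real.log (p : ℝ)) := by rw [div_le_iff₀ h80]; linarith
  -- the certified comparison, divided by `2⁸⁰`
  have hcmp' : ((Ahi : ℝ) + S + (837963523372001241347433 - 2 ^ 79)) / 2 ^ 80 <
      0.57721558 + (LL : ℝ) / 2 ^ 80 +
        (u - u ^ 2 / 2 + u ^ 3 / 3 - u ^ 4 / 4 + u ^ 5 / 5 - u ^ 6 / 6 - u ^ 7 / (1 - u)) := by
    rw [div_lt_iff₀ h80]
    have e : (0.57721558 + (LL : ℝ) / 2 ^ 80 +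
        (u - u ^ 2 / 2 + u ^ 3 / 3 - u ^ 4 / 4 + u ^ 5 / 5 - u ^ 6 / 6 - u ^ 7 / (1 - u))) * 2 ^ 80 =
        2 ^ 80 * 0.57721558 + LL +
          2 ^ 80 * (u - u ^ 2 / 2 + u ^ 3 / 3 - u ^ 4 / 4 + u ^ 5 / 5 - u ^ 6 / 6 - u ^ 7 / (1 - u)) := by
      field_simp
    rw [e]; exact hcmp
  have hSig' : ∑ q ∈ Nat.primesLE p, Real.log ((1 - (q : ℝ)⁻¹)⁻¹) ≤
      ((Ahi : ℝ) + S + (837963523372001241347433 - 2 ^ 79)) / 2 ^ 80 := by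
    rw [le_div_iff₀ h80]; linarith
  linarith

/-- (3.30) on `(1, 5)`: the product is `1`, `2` or `3`, and the right side exceeds `3`.
[cite: RosserSchoenfeld1962, Thm. 8 Cor. (3.30), p. 70] -/
theorem eq_3_30_of_lt_five {x : ℝ} (hx : 1 < x) (hx5 : x < 5) :
    ∏ q ∈ Nat.primesLE ⌊x⌋₊, (q : ℝ) / ((q : ℝ) - 1) <
      Real.exp Real.eulerMascheroniConstant * Real.log x * (1 + 1 / Real.log x ^ 2) := by
  refine lt_of_le_of_lt ?_ (three_lt_rhs hx)
  have hx0 : 0 ≤ x := by linarith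
  have hfl : ⌊x⌋₊ < 5 := (Nat.floor_lt hx0).2 hx5
  have key : ∀ n : ℕ, n < 5 → ∏ q ∈ Nat.primesLE n, (q : ℝ) / ((q : ℝ) - 1) ≤ 3 := by
    intro n hn
    interval_cases n
    · simp
    · simp
    · rw [Mertens.primesLE_two, Finset.prod_singleton]; norm_num
    · rw [show Nat.primesLE 3 = {2, 3} by decide, Finset.prod_insert (by decide), Finset.prod_singleton]; norm_num
    · rw [show Nat.primesLE 4 = {2, 3} by decide, Finset.prod_insert (by decide), Finset.prod_singleton]; norm_num
  exact key _ hfl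

/-! ### The gaps `[p, p')`, `5 ≤ p ≤ 283`, from the tree's per-prime chain states -/
/-- (3.30) on `[5, 7)`. [cite: RosserSchoenfeld1962, Thm. 8 Cor. (3.30), p. 70] -/
theorem gap_5 {x : ℝ} (h1 : (5 : ℝ) ≤ x) (h2 : x < 7) :
    ∏ q ∈ Nat.primesLE ⌊x⌋₊, (q : ℝ) / ((q : ℝ) - 1) <
      Real.exp Real.eulerMascheroniConstant * Real.log x * (1 + 1 / Real.log x ^ 2) :=
  eq_3_30_on_gap RosserSchoenfeldEq327.invA_5 RosserSchoenfeldEq320.inv_5 (p' := 7)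
    (fun q hq1 hq2 hq => by interval_cases q; all_goals exact absurd hq (by norm_num)) 404810 (by norm_num) (by norm_num)
    (by exact_mod_cast h1) (by exact_mod_cast h2)

/-- (3.30) on `[7, 11)`. [cite: RosserSchoenfeld1962, Thm. 8 Cor. (3.30), p. 70] -/
theorem gap_7 {x : ℝ} (h1 : (7 : ℝ) ≤ x) (h2 : x < 11) :
    ∏ q ∈ Nat.primesLE ⌊x⌋₊, (q : ℝ) / ((q : ℝ) - 1) <
      Real.exp Real.eulerMascheroniConstant * Real.log x * (1 + 1 / Real.log x ^ 2) :=
  eq_3_30_on_gap RosserSchoenfeldEq327.invA_7 RosserSchoenfeldEq320.inv_7 (p' := 11)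
    (fun q hq1 hq2 hq => by interval_cases q; all_goals exact absurd hq (by norm_num)) 276920 (by norm_num) (by norm_num)
    (by exact_mod_cast h1) (by exact_mod_cast h2)

/-- (3.30) on `[11, 13)`. [cite: RosserSchoenfeld1962, Thm. 8 Cor. (3.30), p. 70] -/
theorem gap_11 {x : ℝ} (h1 : (11 : ℝ) ≤ x) (h2 : x < 13) :
    ∏ q ∈ Nat.primesLE ⌊x⌋₊, (q : ℝ) / ((q : ℝ) - 1) <
      Real.exp Real.eulerMascheroniConstant * Real.log x * (1 + 1 / Real.log x ^ 2) :=
  eq_3_30_on_gap RosserSchoenfeldEq327.invA_11 RosserSchoenfeldEq320.inv_11 (p' := 13)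
    (fun q hq1 hq2 hq => by interval_cases q; all_goals exact absurd hq (by norm_num)) 182364 (by norm_num) (by norm_num)
    (by exact_mod_cast h1) (by exact_mod_cast h2)

/-- (3.30) on `[13, 17)`. [cite: RosserSchoenfeld1962, Thm. 8 Cor. (3.30), p. 70] -/
theorem gap_13 {x : ℝ} (h1 : (13 : ℝ) ≤ x) (h2 : x < 17) :
    ∏ q ∈ Nat.primesLE ⌊x⌋₊, (q : ℝ) / ((q : ℝ) - 1) <
      Real.exp Real.eulerMascheroniConstant * Real.log x * (1 + 1 / Real.log x ^ 2) :=
  eq_3_30_on_gap RosserSchoenfeldEq327.invA_13 RosserSchoenfeldEq320.inv_13 (p' := 17)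
    (fun q hq1 hq2 hq => by interval_cases q; all_goals exact absurd hq (by norm_num)) 159383 (by norm_num) (by norm_num)
    (by exact_mod_cast h1) (by exact_mod_cast h2)

/-- (3.30) on `[17, 19)`. [cite: RosserSchoenfeld1962, Thm. 8 Cor. (3.30), p. 70] -/
theorem gap_17 {x : ℝ} (h1 : (17 : ℝ) ≤ x) (h2 : x < 19) :
    ∏ q ∈ Nat.primesLE ⌊x⌋₊, (q : ℝ) / ((q : ℝ) - 1) <
      Real.exp Real.eulerMascheroniConstant * Real.log x * (1 + 1 / Real.log x ^ 2) :=
  eq_3_30_on_gap RosserSchoenfeldEq327.invA_17 RosserSchoenfeldEq320.inv_17 (p' := 19)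
    (fun q hq1 hq2 hq => by interval_cases q; all_goals exact absurd hq (by norm_num)) 130629 (by norm_num) (by norm_num)
    (by exact_mod_cast h1) (by exact_mod_cast h2)

/-- (3.30) on `[19, 23)`. [cite: RosserSchoenfeld1962, Thm. 8 Cor. (3.30), p. 70] -/
theorem gap_19 {x : ℝ} (h1 : (19 : ℝ) ≤ x) (h2 : x < 23) :
    ∏ q ∈ Nat.primesLE ⌊x⌋₊, (q : ℝ) / ((q : ℝ) - 1) <
      Real.exp Real.eulerMascheroniConstant * Real.log x * (1 + 1 / Real.log x ^ 2) :=
  eq_3_30_on_gap RosserSchoenfeldEq327.invA_19 RosserSchoenfeldEq320.inv_19 (p' := 23)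
    (fun q hq1 hq2 hq => by interval_cases q; all_goals exact absurd hq (by norm_num)) 120946 (by norm_num) (by norm_num)
    (by exact_mod_cast h1) (by exact_mod_cast h2)

/-- (3.30) on `[23, 29)`. [cite: RosserSchoenfeld1962, Thm. 8 Cor. (3.30), p. 70] -/
theorem gap_23 {x : ℝ} (h1 : (23 : ℝ) ≤ x) (h2 : x < 29) :
    ∏ q ∈ Nat.primesLE ⌊x⌋₊, (q : ℝ) / ((q : ℝ) - 1) <
      Real.exp Real.eulerMascheroniConstant * Real.log x * (1 + 1 / Real.log x ^ 2) :=
  eq_3_30_on_gap RosserSchoenfeldEq327.invA_23 RosserSchoenfeldEq320.inv_23 (p' := 29)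
    (fun q hq1 hq2 hq => by interval_cases q; all_goals exact absurd hq (by norm_num)) 106656 (by norm_num) (by norm_num)
    (by exact_mod_cast h1) (by exact_mod_cast h2)

/-- (3.30) on `[29, 31)`. [cite: RosserSchoenfeld1962, Thm. 8 Cor. (3.30), p. 70] -/
theorem gap_29 {x : ℝ} (h1 : (29 : ℝ) ≤ x) (h2 : x < 31) :
    ∏ q ∈ Nat.primesLE ⌊x⌋₊, (q : ℝ) / ((q : ℝ) - 1) <
      Real.exp Real.eulerMascheroniConstant * Real.log x * (1 + 1 / Real.log x ^ 2) :=
  eq_3_30_on_gap RosserSchoenfeldEq327.invA_29 RosserSchoenfeldEq320.inv_29 (p' := 31)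
    (fun q hq1 hq2 hq => by interval_cases q; all_goals exact absurd hq (by norm_num)) 92477 (by norm_num) (by norm_num)
    (by exact_mod_cast h1) (by exact_mod_cast h2)

/-- (3.30) on `[31, 37)`. [cite: RosserSchoenfeld1962, Thm. 8 Cor. (3.30), p. 70] -/
theorem gap_31 {x : ℝ} (h1 : (31 : ℝ) ≤ x) (h2 : x < 37) :
    ∏ q ∈ Nat.primesLE ⌊x⌋₊, (q : ℝ) / ((q : ℝ) - 1) <
      Real.exp Real.eulerMascheroniConstant * Real.log x * (1 + 1 / Real.log x ^ 2) :=
  eq_3_30_on_gap RosserSchoenfeldEq327.invA_31 RosserSchoenfeldEq320.inv_31 (p' := 37)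
    (fun q hq1 hq2 hq => by interval_cases q; all_goals exact absurd hq (by norm_num)) 88920 (by norm_num) (by norm_num)
    (by exact_mod_cast h1) (by exact_mod_cast h2)

/-- (3.30) on `[37, 41)`. [cite: RosserSchoenfeld1962, Thm. 8 Cor. (3.30), p. 70] -/
theorem gap_37 {x : ℝ} (h1 : (37 : ℝ) ≤ x) (h2 : x < 41) :
    ∏ q ∈ Nat.primesLE ⌊x⌋₊, (q : ℝ) / ((q : ℝ) - 1) <
      Real.exp Real.eulerMascheroniConstant * Real.log x * (1 + 1 / Real.log x ^ 2) :=
  eq_3_30_on_gap RosserSchoenfeldEq327.invA_37 RosserSchoenfeldEq320.inv_37 (p' := 41)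
    (fun q hq1 hq2 hq => by interval_cases q; all_goals exact absurd hq (by norm_num)) 80420 (by norm_num) (by norm_num)
    (by exact_mod_cast h1) (by exact_mod_cast h2)

/-- (3.30) on `[41, 43)`. [cite: RosserSchoenfeld1962, Thm. 8 Cor. (3.30), p. 70] -/
theorem gap_41 {x : ℝ} (h1 : (41 : ℝ) ≤ x) (h2 : x < 43) :
    ∏ q ∈ Nat.primesLE ⌊x⌋₊, (q : ℝ) / ((q : ℝ) - 1) <
      Real.exp Real.eulerMascheroniConstant * Real.log x * (1 + 1 / Real.log x ^ 2) :=
  eq_3_30_on_gap RosserSchoenfeldEq327.invA_41 RosserSchoenfeldEq320.inv_41 (p' := 43)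
    (fun q hq1 hq2 hq => by interval_cases q; all_goals exact absurd hq (by norm_num)) 76035 (by norm_num) (by norm_num)
    (by exact_mod_cast h1) (by exact_mod_cast h2)

/-- (3.30) on `[43, 47)`. [cite: RosserSchoenfeld1962, Thm. 8 Cor. (3.30), p. 70] -/
theorem gap_43 {x : ℝ} (h1 : (43 : ℝ) ≤ x) (h2 : x < 47) :
    ∏ q ∈ Nat.primesLE ⌊x⌋₊, (q : ℝ) / ((q : ℝ) - 1) <
      Real.exp Real.eulerMascheroniConstant * Real.log x * (1 + 1 / Real.log x ^ 2) :=
  eq_3_30_on_gap RosserSchoenfeldEq327.invA_43 RosserSchoenfeldEq320.inv_43 (p' := 47)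
    (fun q hq1 hq2 hq => by interval_cases q; all_goals exact absurd hq (by norm_num)) 74121 (by norm_num) (by norm_num)
    (by exact_mod_cast h1) (by exact_mod_cast h2)

/-- (3.30) on `[47, 53)`. [cite: RosserSchoenfeld1962, Thm. 8 Cor. (3.30), p. 70] -/
theorem gap_47 {x : ℝ} (h1 : (47 : ℝ) ≤ x) (h2 : x < 53) :
    ∏ q ∈ Nat.primesLE ⌊x⌋₊, (q : ℝ) / ((q : ℝ) - 1) <
      Real.exp Real.eulerMascheroniConstant * Real.log x * (1 + 1 / Real.log x ^ 2) :=
  eq_3_30_on_gap RosserSchoenfeldEq327.invA_47 RosserSchoenfeldEq320.inv_47 (p' := 53)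
    (fun q hq1 hq2 hq => by interval_cases q; all_goals exact absurd hq (by norm_num)) 70736 (by norm_num) (by norm_num)
    (by exact_mod_cast h1) (by exact_mod_cast h2)

/-- (3.30) on `[53, 59)`. [cite: RosserSchoenfeld1962, Thm. 8 Cor. (3.30), p. 70] -/
theorem gap_53 {x : ℝ} (h1 : (53 : ℝ) ≤ x) (h2 : x < 59) :
    ∏ q ∈ Nat.primesLE ⌊x⌋₊, (q : ℝ) / ((q : ℝ) - 1) <
      Real.exp Real.eulerMascheroniConstant * Real.log x * (1 + 1 / Real.log x ^ 2) :=
  eq_3_30_on_gap RosserSchoenfeldEq327.invA_53 RosserSchoenfeldEq320.inv_53 (p' := 59)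
    (fun q hq1 hq2 hq => by interval_cases q; all_goals exact absurd hq (by norm_num)) 66520 (by norm_num) (by norm_num)
    (by exact_mod_cast h1) (by exact_mod_cast h2)

/-- (3.30) on `[59, 61)`. [cite: RosserSchoenfeld1962, Thm. 8 Cor. (3.30), p. 70] -/
theorem gap_59 {x : ℝ} (h1 : (59 : ℝ) ≤ x) (h2 : x < 61) :
    ∏ q ∈ Nat.primesLE ⌊x⌋₊, (q : ℝ) / ((q : ℝ) - 1) <
      Real.exp Real.eulerMascheroniConstant * Real.log x * (1 + 1 / Real.log x ^ 2) :=
  eq_3_30_on_gap RosserSchoenfeldEq327.invA_59 RosserSchoenfeldEq320.inv_59 (p' := 61)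
    (fun q hq1 hq2 hq => by interval_cases q; all_goals exact absurd hq (by norm_num)) 63067 (by norm_num) (by norm_num)
    (by exact_mod_cast h1) (by exact_mod_cast h2)

/-- (3.30) on `[61, 67)`. [cite: RosserSchoenfeld1962, Thm. 8 Cor. (3.30), p. 70] -/
theorem gap_61 {x : ℝ} (h1 : (61 : ℝ) ≤ x) (h2 : x < 67) :
    ∏ q ∈ Nat.primesLE ⌊x⌋₊, (q : ℝ) / ((q : ℝ) - 1) <
      Real.exp Real.eulerMascheroniConstant * Real.log x * (1 + 1 / Real.log x ^ 2) :=
  eq_3_30_on_gap RosserSchoenfeldEq327.invA_61 RosserSchoenfeldEq320.inv_61 (p' := 67)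
    (fun q hq1 hq2 hq => by interval_cases q; all_goals exact absurd hq (by norm_num)) 62048 (by norm_num) (by norm_num)
    (by exact_mod_cast h1) (by exact_mod_cast h2)

/-- (3.30) on `[67, 71)`. [cite: RosserSchoenfeld1962, Thm. 8 Cor. (3.30), p. 70] -/
theorem gap_67 {x : ℝ} (h1 : (67 : ℝ) ≤ x) (h2 : x < 71) :
    ∏ q ∈ Nat.primesLE ⌊x⌋₊, (q : ℝ) / ((q : ℝ) - 1) <
      Real.exp Real.eulerMascheroniConstant * Real.log x * (1 + 1 / Real.log x ^ 2) :=
  eq_3_30_on_gap RosserSchoenfeldEq327.invA_67 RosserSchoenfeldEq320.inv_67 (p' := 71)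
    (fun q hq1 hq2 hq => by interval_cases q; all_goals exact absurd hq (by norm_num)) 59310 (by norm_num) (by norm_num)
    (by exact_mod_cast h1) (by exact_mod_cast h2)

/-- (3.30) on `[71, 73)`. [cite: RosserSchoenfeld1962, Thm. 8 Cor. (3.30), p. 70] -/
theorem gap_71 {x : ℝ} (h1 : (71 : ℝ) ≤ x) (h2 : x < 73) :
    ∏ q ∈ Nat.primesLE ⌊x⌋₊, (q : ℝ) / ((q : ℝ) - 1) <
      Real.exp Real.eulerMascheroniConstant * Real.log x * (1 + 1 / Real.log x ^ 2) :=
  eq_3_30_on_gap RosserSchoenfeldEq327.invA_71 RosserSchoenfeldEq320.inv_71 (p' := 73)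
    (fun q hq1 hq2 hq => by interval_cases q; all_goals exact absurd hq (by norm_num)) 57707 (by norm_num) (by norm_num)
    (by exact_mod_cast h1) (by exact_mod_cast h2)

/-- (3.30) on `[73, 79)`. [cite: RosserSchoenfeld1962, Thm. 8 Cor. (3.30), p. 70] -/
theorem gap_73 {x : ℝ} (h1 : (73 : ℝ) ≤ x) (h2 : x < 79) :
    ∏ q ∈ Nat.primesLE ⌊x⌋₊, (q : ℝ) / ((q : ℝ) - 1) <
      Real.exp Real.eulerMascheroniConstant * Real.log x * (1 + 1 / Real.log x ^ 2) :=
  eq_3_30_on_gap RosserSchoenfeldEq327.invA_73 RosserSchoenfeldEq320.inv_73 (p' := 79)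
    (fun q hq1 hq2 hq => by interval_cases q; all_goals exact absurd hq (by norm_num)) 56962 (by norm_num) (by norm_num)
    (by exact_mod_cast h1) (by exact_mod_cast h2)

/-- (3.30) on `[79, 83)`. [cite: RosserSchoenfeld1962, Thm. 8 Cor. (3.30), p. 70] -/
theorem gap_79 {x : ℝ} (h1 : (79 : ℝ) ≤ x) (h2 : x < 83) :
    ∏ q ∈ Nat.primesLE ⌊x⌋₊, (q : ℝ) / ((q : ℝ) - 1) <
      Real.exp Real.eulerMascheroniConstant * Real.log x * (1 + 1 / Real.log x ^ 2) :=
  eq_3_30_on_gap RosserSchoenfeldEq327.invA_79 RosserSchoenfeldEq320.inv_79 (p' := 83)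
    (fun q hq1 hq2 hq => by interval_cases q; all_goals exact absurd hq (by norm_num)) 54922 (by norm_num) (by norm_num)
    (by exact_mod_cast h1) (by exact_mod_cast h2)

/-- (3.30) on `[83, 89)`. [cite: RosserSchoenfeld1962, Thm. 8 Cor. (3.30), p. 70] -/
theorem gap_83 {x : ℝ} (h1 : (83 : ℝ) ≤ x) (h2 : x < 89) :
    ∏ q ∈ Nat.primesLE ⌊x⌋₊, (q : ℝ) / ((q : ℝ) - 1) <
      Real.exp Real.eulerMascheroniConstant * Real.log x * (1 + 1 / Real.log x ^ 2) :=
  eq_3_30_on_gap RosserSchoenfeldEq327.invA_83 RosserSchoenfeldEq320.inv_83 (p' := 89)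
    (fun q hq1 hq2 hq => by interval_cases q; all_goals exact absurd hq (by norm_num)) 53701 (by norm_num) (by norm_num)
    (by exact_mod_cast h1) (by exact_mod_cast h2)

/-- (3.30) on `[89, 97)`. [cite: RosserSchoenfeld1962, Thm. 8 Cor. (3.30), p. 70] -/
theorem gap_89 {x : ℝ} (h1 : (89 : ℝ) ≤ x) (h2 : x < 97) :
    ∏ q ∈ Nat.primesLE ⌊x⌋₊, (q : ℝ) / ((q : ℝ) - 1) <
      Real.exp Real.eulerMascheroniConstant * Real.log x * (1 + 1 / Real.log x ^ 2) :=
  eq_3_30_on_gap RosserSchoenfeldEq327.invA_89 RosserSchoenfeldEq320.inv_89 (p' := 97)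
    (fun q hq1 hq2 hq => by interval_cases q; all_goals exact absurd hq (by norm_num)) 52044 (by norm_num) (by norm_num)
    (by exact_mod_cast h1) (by exact_mod_cast h2)

/-- (3.30) on `[97, 101)`. [cite: RosserSchoenfeld1962, Thm. 8 Cor. (3.30), p. 70] -/
theorem gap_97 {x : ℝ} (h1 : (97 : ℝ) ≤ x) (h2 : x < 101) :
    ∏ q ∈ Nat.primesLE ⌊x⌋₊, (q : ℝ) / ((q : ℝ) - 1) <
      Real.exp Real.eulerMascheroniConstant * Real.log x * (1 + 1 / Real.log x ^ 2) :=
  eq_3_30_on_gap RosserSchoenfeldEq327.invA_97 RosserSchoenfeldEq320.inv_97 (p' := 101)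
    (fun q hq1 hq2 hq => by interval_cases q; all_goals exact absurd hq (by norm_num)) 50104 (by norm_num) (by norm_num)
    (by exact_mod_cast h1) (by exact_mod_cast h2)

/-- (3.30) on `[101, 103)`. [cite: RosserSchoenfeld1962, Thm. 8 Cor. (3.30), p. 70] -/
theorem gap_101 {x : ℝ} (h1 : (101 : ℝ) ≤ x) (h2 : x < 103) :
    ∏ q ∈ Nat.primesLE ⌊x⌋₊, (q : ℝ) / ((q : ℝ) - 1) <
      Real.exp Real.eulerMascheroniConstant * Real.log x * (1 + 1 / Real.log x ^ 2) :=
  eq_3_30_on_gap RosserSchoenfeldEq327.invA_101 RosserSchoenfeldEq320.inv_101 (p' := 103)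
    (fun q hq1 hq2 hq => by interval_cases q; all_goals exact absurd hq (by norm_num)) 49230 (by norm_num) (by norm_num)
    (by exact_mod_cast h1) (by exact_mod_cast h2)

/-- (3.30) on `[103, 107)`. [cite: RosserSchoenfeld1962, Thm. 8 Cor. (3.30), p. 70] -/
theorem gap_103 {x : ℝ} (h1 : (103 : ℝ) ≤ x) (h2 : x < 107) :
    ∏ q ∈ Nat.primesLE ⌊x⌋₊, (q : ℝ) / ((q : ℝ) - 1) <
      Real.exp Real.eulerMascheroniConstant * Real.log x * (1 + 1 / Real.log x ^ 2) :=
  eq_3_30_on_gap RosserSchoenfeldEq327.invA_103 RosserSchoenfeldEq320.inv_103 (p' := 107)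
    (fun q hq1 hq2 hq => by interval_cases q; all_goals exact absurd hq (by norm_num)) 48814 (by norm_num) (by norm_num)
    (by exact_mod_cast h1) (by exact_mod_cast h2)

/-- (3.30) on `[107, 109)`. [cite: RosserSchoenfeld1962, Thm. 8 Cor. (3.30), p. 70] -/
theorem gap_107 {x : ℝ} (h1 : (107 : ℝ) ≤ x) (h2 : x < 109) :
    ∏ q ∈ Nat.primesLE ⌊x⌋₊, (q : ℝ) / ((q : ℝ) - 1) <
      Real.exp Real.eulerMascheroniConstant * Real.log x * (1 + 1 / Real.log x ^ 2) :=
  eq_3_30_on_gap RosserSchoenfeldEq327.invA_107 RosserSchoenfeldEq320.inv_107 (p' := 109)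
    (fun q hq1 hq2 hq => by interval_cases q; all_goals exact absurd hq (by norm_num)) 48021 (by norm_num) (by norm_num)
    (by exact_mod_cast h1) (by exact_mod_cast h2)

/-- (3.30) on `[109, 113)`. [cite: RosserSchoenfeld1962, Thm. 8 Cor. (3.30), p. 70] -/
theorem gap_109 {x : ℝ} (h1 : (109 : ℝ) ≤ x) (h2 : x < 113) :
    ∏ q ∈ Nat.primesLE ⌊x⌋₊, (q : ℝ) / ((q : ℝ) - 1) <
      Real.exp Real.eulerMascheroniConstant * Real.log x * (1 + 1 / Real.log x ^ 2) :=
  eq_3_30_on_gap RosserSchoenfeldEq327.invA_109 RosserSchoenfeldEq320.inv_109 (p' := 113)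
    (fun q hq1 hq2 hq => by interval_cases q; all_goals exact absurd hq (by norm_num)) 47643 (by norm_num) (by norm_num)
    (by exact_mod_cast h1) (by exact_mod_cast h2)

/-- (3.30) on `[113, 127)`. [cite: RosserSchoenfeld1962, Thm. 8 Cor. (3.30), p. 70] -/
theorem gap_113 {x : ℝ} (h1 : (113 : ℝ) ≤ x) (h2 : x < 127) :
    ∏ q ∈ Nat.primesLE ⌊x⌋₊, (q : ℝ) / ((q : ℝ) - 1) <
      Real.exp Real.eulerMascheroniConstant * Real.log x * (1 + 1 / Real.log x ^ 2) :=
  eq_3_30_on_gap RosserSchoenfeldEq327.invA_113 RosserSchoenfeldEq320.inv_113 (p' := 127)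
    (fun q hq1 hq2 hq => by interval_cases q; all_goals exact absurd hq (by norm_num)) 46919 (by norm_num) (by norm_num)
    (by exact_mod_cast h1) (by exact_mod_cast h2)

/-- (3.30) on `[127, 131)`. [cite: RosserSchoenfeld1962, Thm. 8 Cor. (3.30), p. 70] -/
theorem gap_127 {x : ℝ} (h1 : (127 : ℝ) ≤ x) (h2 : x < 131) :
    ∏ q ∈ Nat.primesLE ⌊x⌋₊, (q : ℝ) / ((q : ℝ) - 1) <
      Real.exp Real.eulerMascheroniConstant * Real.log x * (1 + 1 / Real.log x ^ 2) :=
  eq_3_30_on_gap RosserSchoenfeldEq327.invA_127 RosserSchoenfeldEq320.inv_127 (p' := 131)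
    (fun q hq1 hq2 hq => by interval_cases q; all_goals exact absurd hq (by norm_num)) 44684 (by norm_num) (by norm_num)
    (by exact_mod_cast h1) (by exact_mod_cast h2)

/-- (3.30) on `[131, 137)`. [cite: RosserSchoenfeld1962, Thm. 8 Cor. (3.30), p. 70] -/
theorem gap_131 {x : ℝ} (h1 : (131 : ℝ) ≤ x) (h2 : x < 137) :
    ∏ q ∈ Nat.primesLE ⌊x⌋₊, (q : ℝ) / ((q : ℝ) - 1) <
      Real.exp Real.eulerMascheroniConstant * Real.log x * (1 + 1 / Real.log x ^ 2) :=
  eq_3_30_on_gap RosserSchoenfeldEq327.invA_131 RosserSchoenfeldEq320.inv_131 (p' := 137)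
    (fun q hq1 hq2 hq => by interval_cases q; all_goals exact absurd hq (by norm_num)) 44117 (by norm_num) (by norm_num)
    (by exact_mod_cast h1) (by exact_mod_cast h2)

/-- (3.30) on `[137, 139)`. [cite: RosserSchoenfeld1962, Thm. 8 Cor. (3.30), p. 70] -/
theorem gap_137 {x : ℝ} (h1 : (137 : ℝ) ≤ x) (h2 : x < 139) :
    ∏ q ∈ Nat.primesLE ⌊x⌋₊, (q : ℝ) / ((q : ℝ) - 1) <
      Real.exp Real.eulerMascheroniConstant * Real.log x * (1 + 1 / Real.log x ^ 2) :=
  eq_3_30_on_gap RosserSchoenfeldEq327.invA_137 RosserSchoenfeldEq320.inv_137 (p' := 139)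
    (fun q hq1 hq2 hq => by interval_cases q; all_goals exact absurd hq (by norm_num)) 43318 (by norm_num) (by norm_num)
    (by exact_mod_cast h1) (by exact_mod_cast h2)

/-- (3.30) on `[139, 149)`. [cite: RosserSchoenfeld1962, Thm. 8 Cor. (3.30), p. 70] -/
theorem gap_139 {x : ℝ} (h1 : (139 : ℝ) ≤ x) (h2 : x < 149) :
    ∏ q ∈ Nat.primesLE ⌊x⌋₊, (q : ℝ) / ((q : ℝ) - 1) <
      Real.exp Real.eulerMascheroniConstant * Real.log x * (1 + 1 / Real.log x ^ 2) :=
  eq_3_30_on_gap RosserSchoenfeldEq327.invA_139 RosserSchoenfeldEq320.inv_139 (p' := 149)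
    (fun q hq1 hq2 hq => by interval_cases q; all_goals exact absurd hq (by norm_num)) 43064 (by norm_num) (by norm_num)
    (by exact_mod_cast h1) (by exact_mod_cast h2)

/-- (3.30) on `[149, 151)`. [cite: RosserSchoenfeld1962, Thm. 8 Cor. (3.30), p. 70] -/
theorem gap_149 {x : ℝ} (h1 : (149 : ℝ) ≤ x) (h2 : x < 151) :
    ∏ q ∈ Nat.primesLE ⌊x⌋₊, (q : ℝ) / ((q : ℝ) - 1) <
      Real.exp Real.eulerMascheroniConstant * Real.log x * (1 + 1 / Real.log x ^ 2) :=
  eq_3_30_on_gap RosserSchoenfeldEq327.invA_149 RosserSchoenfeldEq320.inv_149 (p' := 151)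
    (fun q hq1 hq2 hq => by interval_cases q; all_goals exact absurd hq (by norm_num)) 41876 (by norm_num) (by norm_num)
    (by exact_mod_cast h1) (by exact_mod_cast h2)

/-- (3.30) on `[151, 157)`. [cite: RosserSchoenfeld1962, Thm. 8 Cor. (3.30), p. 70] -/
theorem gap_151 {x : ℝ} (h1 : (151 : ℝ) ≤ x) (h2 : x < 157) :
    ∏ q ∈ Nat.primesLE ⌊x⌋₊, (q : ℝ) / ((q : ℝ) - 1) <
      Real.exp Real.eulerMascheroniConstant * Real.log x * (1 + 1 / Real.log x ^ 2) :=
  eq_3_30_on_gap RosserSchoenfeldEq327.invA_151 RosserSchoenfeldEq320.inv_151 (p' := 157)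
    (fun q hq1 hq2 hq => by interval_cases q; all_goals exact absurd hq (by norm_num)) 41654 (by norm_num) (by norm_num)
    (by exact_mod_cast h1) (by exact_mod_cast h2)

/-- (3.30) on `[157, 163)`. [cite: RosserSchoenfeld1962, Thm. 8 Cor. (3.30), p. 70] -/
theorem gap_157 {x : ℝ} (h1 : (157 : ℝ) ≤ x) (h2 : x < 163) :
    ∏ q ∈ Nat.primesLE ⌊x⌋₊, (q : ℝ) / ((q : ℝ) - 1) <
      Real.exp Real.eulerMascheroniConstant * Real.log x * (1 + 1 / Real.log x ^ 2) :=
  eq_3_30_on_gap RosserSchoenfeldEq327.invA_157 RosserSchoenfeldEq320.inv_157 (p' := 163)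
    (fun q hq1 hq2 hq => by interval_cases q; all_goals exact absurd hq (by norm_num)) 41015 (by norm_num) (by norm_num)
    (by exact_mod_cast h1) (by exact_mod_cast h2)

/-- (3.30) on `[163, 167)`. [cite: RosserSchoenfeld1962, Thm. 8 Cor. (3.30), p. 70] -/
theorem gap_163 {x : ℝ} (h1 : (163 : ℝ) ≤ x) (h2 : x < 167) :
    ∏ q ∈ Nat.primesLE ⌊x⌋₊, (q : ℝ) / ((q : ℝ) - 1) <
      Real.exp Real.eulerMascheroniConstant * Real.log x * (1 + 1 / Real.log x ^ 2) :=
  eq_3_30_on_gap RosserSchoenfeldEq327.invA_163 RosserSchoenfeldEq320.inv_163 (p' := 167)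
    (fun q hq1 hq2 hq => by interval_cases q; all_goals exact absurd hq (by norm_num)) 40413 (by norm_num) (by norm_num)
    (by exact_mod_cast h1) (by exact_mod_cast h2)

/-- (3.30) on `[167, 173)`. [cite: RosserSchoenfeld1962, Thm. 8 Cor. (3.30), p. 70] -/
theorem gap_167 {x : ℝ} (h1 : (167 : ℝ) ≤ x) (h2 : x < 173) :
    ∏ q ∈ Nat.primesLE ⌊x⌋₊, (q : ℝ) / ((q : ℝ) - 1) <
      Real.exp Real.eulerMascheroniConstant * Real.log x * (1 + 1 / Real.log x ^ 2) :=
  eq_3_30_on_gap RosserSchoenfeldEq327.invA_167 RosserSchoenfeldEq320.inv_167 (p' := 173)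
    (fun q hq1 hq2 hq => by interval_cases q; all_goals exact absurd hq (by norm_num)) 40031 (by norm_num) (by norm_num)
    (by exact_mod_cast h1) (by exact_mod_cast h2)

/-- (3.30) on `[173, 179)`. [cite: RosserSchoenfeld1962, Thm. 8 Cor. (3.30), p. 70] -/
theorem gap_173 {x : ℝ} (h1 : (173 : ℝ) ≤ x) (h2 : x < 179) :
    ∏ q ∈ Nat.primesLE ⌊x⌋₊, (q : ℝ) / ((q : ℝ) - 1) <
      Real.exp Real.eulerMascheroniConstant * Real.log x * (1 + 1 / Real.log x ^ 2) :=
  eq_3_30_on_gap RosserSchoenfeldEq327.invA_173 RosserSchoenfeldEq320.inv_173 (p' := 179)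
    (fun q hq1 hq2 hq => by interval_cases q; all_goals exact absurd hq (by norm_num)) 39484 (by norm_num) (by norm_num)
    (by exact_mod_cast h1) (by exact_mod_cast h2)

/-- (3.30) on `[179, 181)`. [cite: RosserSchoenfeld1962, Thm. 8 Cor. (3.30), p. 70] -/
theorem gap_179 {x : ℝ} (h1 : (179 : ℝ) ≤ x) (h2 : x < 181) :
    ∏ q ∈ Nat.primesLE ⌊x⌋₊, (q : ℝ) / ((q : ℝ) - 1) <
      Real.exp Real.eulerMascheroniConstant * Real.log x * (1 + 1 / Real.log x ^ 2) :=
  eq_3_30_on_gap RosserSchoenfeldEq327.invA_179 RosserSchoenfeldEq320.inv_179 (p' := 181)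
    (fun q hq1 hq2 hq => by interval_cases q; all_goals exact absurd hq (by norm_num)) 38967 (by norm_num) (by norm_num)
    (by exact_mod_cast h1) (by exact_mod_cast h2)

/-- (3.30) on `[181, 191)`. [cite: RosserSchoenfeld1962, Thm. 8 Cor. (3.30), p. 70] -/
theorem gap_181 {x : ℝ} (h1 : (181 : ℝ) ≤ x) (h2 : x < 191) :
    ∏ q ∈ Nat.primesLE ⌊x⌋₊, (q : ℝ) / ((q : ℝ) - 1) <
      Real.exp Real.eulerMascheroniConstant * Real.log x * (1 + 1 / Real.log x ^ 2) :=
  eq_3_30_on_gap RosserSchoenfeldEq327.invA_181 RosserSchoenfeldEq320.inv_181 (p' := 191)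
    (fun q hq1 hq2 hq => by interval_cases q; all_goals exact absurd hq (by norm_num)) 38801 (by norm_num) (by norm_num)
    (by exact_mod_cast h1) (by exact_mod_cast h2)

/-- (3.30) on `[191, 193)`. [cite: RosserSchoenfeld1962, Thm. 8 Cor. (3.30), p. 70] -/
theorem gap_191 {x : ℝ} (h1 : (191 : ℝ) ≤ x) (h2 : x < 193) :
    ∏ q ∈ Nat.primesLE ⌊x⌋₊, (q : ℝ) / ((q : ℝ) - 1) <
      Real.exp Real.eulerMascheroniConstant * Real.log x * (1 + 1 / Real.log x ^ 2) :=
  eq_3_30_on_gap RosserSchoenfeldEq327.invA_191 RosserSchoenfeldEq320.inv_191 (p' := 193)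
    (fun q hq1 hq2 hq => by interval_cases q; all_goals exact absurd hq (by norm_num)) 38010 (by norm_num) (by norm_num)
    (by exact_mod_cast h1) (by exact_mod_cast h2)

/-- (3.30) on `[193, 197)`. [cite: RosserSchoenfeld1962, Thm. 8 Cor. (3.30), p. 70] -/
theorem gap_193 {x : ℝ} (h1 : (193 : ℝ) ≤ x) (h2 : x < 197) :
    ∏ q ∈ Nat.primesLE ⌊x⌋₊, (q : ℝ) / ((q : ℝ) - 1) <
      Real.exp Real.eulerMascheroniConstant * Real.log x * (1 + 1 / Real.log x ^ 2) :=
  eq_3_30_on_gap RosserSchoenfeldEq327.invA_193 RosserSchoenfeldEq320.inv_193 (p' := 197)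
    (fun q hq1 hq2 hq => by interval_cases q; all_goals exact absurd hq (by norm_num)) 37860 (by norm_num) (by norm_num)
    (by exact_mod_cast h1) (by exact_mod_cast h2)

/-- (3.30) on `[197, 199)`. [cite: RosserSchoenfeld1962, Thm. 8 Cor. (3.30), p. 70] -/
theorem gap_197 {x : ℝ} (h1 : (197 : ℝ) ≤ x) (h2 : x < 199) :
    ∏ q ∈ Nat.primesLE ⌊x⌋₊, (q : ℝ) / ((q : ℝ) - 1) <
      Real.exp Real.eulerMascheroniConstant * Real.log x * (1 + 1 / Real.log x ^ 2) :=
  eq_3_30_on_gap RosserSchoenfeldEq327.invA_197 RosserSchoenfeldEq320.inv_197 (p' := 199)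
    (fun q hq1 hq2 hq => by interval_cases q; all_goals exact absurd hq (by norm_num)) 37566 (by norm_num) (by norm_num)
    (by exact_mod_cast h1) (by exact_mod_cast h2)

/-- (3.30) on `[199, 211)`. [cite: RosserSchoenfeld1962, Thm. 8 Cor. (3.30), p. 70] -/
theorem gap_199 {x : ℝ} (h1 : (199 : ℝ) ≤ x) (h2 : x < 211) :
    ∏ q ∈ Nat.primesLE ⌊x⌋₊, (q : ℝ) / ((q : ℝ) - 1) <
      Real.exp Real.eulerMascheroniConstant * Real.log x * (1 + 1 / Real.log x ^ 2) :=
  eq_3_30_on_gap RosserSchoenfeldEq327.invA_199 RosserSchoenfeldEq320.inv_199 (p' := 211)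
    (fun q hq1 hq2 hq => by interval_cases q; all_goals exact absurd hq (by norm_num)) 37423 (by norm_num) (by norm_num)
    (by exact_mod_cast h1) (by exact_mod_cast h2)

/-- (3.30) on `[211, 223)`. [cite: RosserSchoenfeld1962, Thm. 8 Cor. (3.30), p. 70] -/
theorem gap_211 {x : ℝ} (h1 : (211 : ℝ) ≤ x) (h2 : x < 223) :
    ∏ q ∈ Nat.primesLE ⌊x⌋₊, (q : ℝ) / ((q : ℝ) - 1) <
      Real.exp Real.eulerMascheroniConstant * Real.log x * (1 + 1 / Real.log x ^ 2) :=
  eq_3_30_on_gap RosserSchoenfeldEq327.invA_211 RosserSchoenfeldEq320.inv_211 (p' := 223)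
    (fun q hq1 hq2 hq => by interval_cases q; all_goals exact absurd hq (by norm_num)) 36609 (by norm_num) (by norm_num)
    (by exact_mod_cast h1) (by exact_mod_cast h2)

/-- (3.30) on `[223, 227)`. [cite: RosserSchoenfeld1962, Thm. 8 Cor. (3.30), p. 70] -/
theorem gap_223 {x : ℝ} (h1 : (223 : ℝ) ≤ x) (h2 : x < 227) :
    ∏ q ∈ Nat.primesLE ⌊x⌋₊, (q : ℝ) / ((q : ℝ) - 1) <
      Real.exp Real.eulerMascheroniConstant * Real.log x * (1 + 1 / Real.log x ^ 2) :=
  eq_3_30_on_gap RosserSchoenfeldEq327.invA_223 RosserSchoenfeldEq320.inv_223 (p' := 227)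
    (fun q hq1 hq2 hq => by interval_cases q; all_goals exact absurd hq (by norm_num)) 35864 (by norm_num) (by norm_num)
    (by exact_mod_cast h1) (by exact_mod_cast h2)

/-- (3.30) on `[227, 229)`. [cite: RosserSchoenfeld1962, Thm. 8 Cor. (3.30), p. 70] -/
theorem gap_227 {x : ℝ} (h1 : (227 : ℝ) ≤ x) (h2 : x < 229) :
    ∏ q ∈ Nat.primesLE ⌊x⌋₊, (q : ℝ) / ((q : ℝ) - 1) <
      Real.exp Real.eulerMascheroniConstant * Real.log x * (1 + 1 / Real.log x ^ 2) :=
  eq_3_30_on_gap RosserSchoenfeldEq327.invA_227 RosserSchoenfeldEq320.inv_227 (p' := 229)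
    (fun q hq1 hq2 hq => by interval_cases q; all_goals exact absurd hq (by norm_num)) 35629 (by norm_num) (by norm_num)
    (by exact_mod_cast h1) (by exact_mod_cast h2)

/-- (3.30) on `[229, 233)`. [cite: RosserSchoenfeld1962, Thm. 8 Cor. (3.30), p. 70] -/
theorem gap_229 {x : ℝ} (h1 : (229 : ℝ) ≤ x) (h2 : x < 233) :
    ∏ q ∈ Nat.primesLE ⌊x⌋₊, (q : ℝ) / ((q : ℝ) - 1) <
      Real.exp Real.eulerMascheroniConstant * Real.log x * (1 + 1 / Real.log x ^ 2) :=
  eq_3_30_on_gap RosserSchoenfeldEq327.invA_229 RosserSchoenfeldEq320.inv_229 (p' := 233)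
    (fun q hq1 hq2 hq => by interval_cases q; all_goals exact absurd hq (by norm_num)) 35514 (by norm_num) (by norm_num)
    (by exact_mod_cast h1) (by exact_mod_cast h2)

/-- (3.30) on `[233, 239)`. [cite: RosserSchoenfeld1962, Thm. 8 Cor. (3.30), p. 70] -/
theorem gap_233 {x : ℝ} (h1 : (233 : ℝ) ≤ x) (h2 : x < 239) :
    ∏ q ∈ Nat.primesLE ⌊x⌋₊, (q : ℝ) / ((q : ℝ) - 1) <
      Real.exp Real.eulerMascheroniConstant * Real.log x * (1 + 1 / Real.log x ^ 2) :=
  eq_3_30_on_gap RosserSchoenfeldEq327.invA_233 RosserSchoenfeldEq320.inv_233 (p' := 239)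
    (fun q hq1 hq2 hq => by interval_cases q; all_goals exact absurd hq (by norm_num)) 35289 (by norm_num) (by norm_num)
    (by exact_mod_cast h1) (by exact_mod_cast h2)

/-- (3.30) on `[239, 241)`. [cite: RosserSchoenfeld1962, Thm. 8 Cor. (3.30), p. 70] -/
theorem gap_239 {x : ℝ} (h1 : (239 : ℝ) ≤ x) (h2 : x < 241) :
    ∏ q ∈ Nat.primesLE ⌊x⌋₊, (q : ℝ) / ((q : ℝ) - 1) <
      Real.exp Real.eulerMascheroniConstant * Real.log x * (1 + 1 / Real.log x ^ 2) :=
  eq_3_30_on_gap RosserSchoenfeldEq327.invA_239 RosserSchoenfeldEq320.inv_239 (p' := 241)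
    (fun q hq1 hq2 hq => by interval_cases q; all_goals exact absurd hq (by norm_num)) 34962 (by norm_num) (by norm_num)
    (by exact_mod_cast h1) (by exact_mod_cast h2)

/-- (3.30) on `[241, 251)`. [cite: RosserSchoenfeld1962, Thm. 8 Cor. (3.30), p. 70] -/
theorem gap_241 {x : ℝ} (h1 : (241 : ℝ) ≤ x) (h2 : x < 251) :
    ∏ q ∈ Nat.primesLE ⌊x⌋₊, (q : ℝ) / ((q : ℝ) - 1) <
      Real.exp Real.eulerMascheroniConstant * Real.log x * (1 + 1 / Real.log x ^ 2) :=
  eq_3_30_on_gap RosserSchoenfeldEq327.invA_241 RosserSchoenfeldEq320.inv_241 (p' := 251)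
    (fun q hq1 hq2 hq => by interval_cases q; all_goals exact absurd hq (by norm_num)) 34856 (by norm_num) (by norm_num)
    (by exact_mod_cast h1) (by exact_mod_cast h2)

/-- (3.30) on `[251, 257)`. [cite: RosserSchoenfeld1962, Thm. 8 Cor. (3.30), p. 70] -/
theorem gap_251 {x : ℝ} (h1 : (251 : ℝ) ≤ x) (h2 : x < 257) :
    ∏ q ∈ Nat.primesLE ⌊x⌋₊, (q : ℝ) / ((q : ℝ) - 1) <
      Real.exp Real.eulerMascheroniConstant * Real.log x * (1 + 1 / Real.log x ^ 2) :=
  eq_3_30_on_gap RosserSchoenfeldEq327.invA_251 RosserSchoenfeldEq320.inv_251 (p' := 257)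
    (fun q hq1 hq2 hq => by interval_cases q; all_goals exact absurd hq (by norm_num)) 34345 (by norm_num) (by norm_num)
    (by exact_mod_cast h1) (by exact_mod_cast h2)

/-- (3.30) on `[257, 263)`. [cite: RosserSchoenfeld1962, Thm. 8 Cor. (3.30), p. 70] -/
theorem gap_257 {x : ℝ} (h1 : (257 : ℝ) ≤ x) (h2 : x < 263) :
    ∏ q ∈ Nat.primesLE ⌊x⌋₊, (q : ℝ) / ((q : ℝ) - 1) <
      Real.exp Real.eulerMascheroniConstant * Real.log x * (1 + 1 / Real.log x ^ 2) :=
  eq_3_30_on_gap RosserSchoenfeldEq327.invA_257 RosserSchoenfeldEq320.inv_257 (p' := 263)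
    (fun q hq1 hq2 hq => by interval_cases q; all_goals exact absurd hq (by norm_num)) 34053 (by norm_num) (by norm_num)
    (by exact_mod_cast h1) (by exact_mod_cast h2)

/-- (3.30) on `[263, 269)`. [cite: RosserSchoenfeld1962, Thm. 8 Cor. (3.30), p. 70] -/
theorem gap_263 {x : ℝ} (h1 : (263 : ℝ) ≤ x) (h2 : x < 269) :
    ∏ q ∈ Nat.primesLE ⌊x⌋₊, (q : ℝ) / ((q : ℝ) - 1) <
      Real.exp Real.eulerMascheroniConstant * Real.log x * (1 + 1 / Real.log x ^ 2) :=
  eq_3_30_on_gap RosserSchoenfeldEq327.invA_263 RosserSchoenfeldEq320.inv_263 (p' := 269)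
    (fun q hq1 hq2 hq => by interval_cases q; all_goals exact absurd hq (by norm_num)) 33771 (by norm_num) (by norm_num)
    (by exact_mod_cast h1) (by exact_mod_cast h2)

/-- (3.30) on `[269, 271)`. [cite: RosserSchoenfeld1962, Thm. 8 Cor. (3.30), p. 70] -/
theorem gap_269 {x : ℝ} (h1 : (269 : ℝ) ≤ x) (h2 : x < 271) :
    ∏ q ∈ Nat.primesLE ⌊x⌋₊, (q : ℝ) / ((q : ℝ) - 1) <
      Real.exp Real.eulerMascheroniConstant * Real.log x * (1 + 1 / Real.log x ^ 2) :=
  eq_3_30_on_gap RosserSchoenfeldEq327.invA_269 RosserSchoenfeldEq320.inv_269 (p' := 271)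
    (fun q hq1 hq2 hq => by interval_cases q; all_goals exact absurd hq (by norm_num)) 33499 (by norm_num) (by norm_num)
    (by exact_mod_cast h1) (by exact_mod_cast h2)

/-- (3.30) on `[271, 277)`. [cite: RosserSchoenfeld1962, Thm. 8 Cor. (3.30), p. 70] -/
theorem gap_271 {x : ℝ} (h1 : (271 : ℝ) ≤ x) (h2 : x < 277) :
    ∏ q ∈ Nat.primesLE ⌊x⌋₊, (q : ℝ) / ((q : ℝ) - 1) <
      Real.exp Real.eulerMascheroniConstant * Real.log x * (1 + 1 / Real.log x ^ 2) :=
  eq_3_30_on_gap RosserSchoenfeldEq327.invA_271 RosserSchoenfeldEq320.inv_271 (p' := 277)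
    (fun q hq1 hq2 hq => by interval_cases q; all_goals exact absurd hq (by norm_num)) 33411 (by norm_num) (by norm_num)
    (by exact_mod_cast h1) (by exact_mod_cast h2)

/-- (3.30) on `[277, 281)`. [cite: RosserSchoenfeld1962, Thm. 8 Cor. (3.30), p. 70] -/
theorem gap_277 {x : ℝ} (h1 : (277 : ℝ) ≤ x) (h2 : x < 281) :
    ∏ q ∈ Nat.primesLE ⌊x⌋₊, (q : ℝ) / ((q : ℝ) - 1) <
      Real.exp Real.eulerMascheroniConstant * Real.log x * (1 + 1 / Real.log x ^ 2) :=
  eq_3_30_on_gap RosserSchoenfeldEq327.invA_277 RosserSchoenfeldEq320.inv_277 (p' := 281)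
    (fun q hq1 hq2 hq => by interval_cases q; all_goals exact absurd hq (by norm_num)) 33151 (by norm_num) (by norm_num)
    (by exact_mod_cast h1) (by exact_mod_cast h2)

/-- (3.30) on `[281, 283)`. [cite: RosserSchoenfeld1962, Thm. 8 Cor. (3.30), p. 70] -/
theorem gap_281 {x : ℝ} (h1 : (281 : ℝ) ≤ x) (h2 : x < 283) :
    ∏ q ∈ Nat.primesLE ⌊x⌋₊, (q : ℝ) / ((q : ℝ) - 1) <
      Real.exp Real.eulerMascheroniConstant * Real.log x * (1 + 1 / Real.log x ^ 2) :=
  eq_3_30_on_gap RosserSchoenfeldEq327.invA_281 RosserSchoenfeldEq320.inv_281 (p' := 283)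
    (fun q hq1 hq2 hq => by interval_cases q; all_goals exact absurd hq (by norm_num)) 32983 (by norm_num) (by norm_num)
    (by exact_mod_cast h1) (by exact_mod_cast h2)

/-- (3.30) on `[283, 293)`. [cite: RosserSchoenfeld1962, Thm. 8 Cor. (3.30), p. 70] -/
theorem gap_283 {x : ℝ} (h1 : (283 : ℝ) ≤ x) (h2 : x < 293) :
    ∏ q ∈ Nat.primesLE ⌊x⌋₊, (q : ℝ) / ((q : ℝ) - 1) <
      Real.exp Real.eulerMascheroniConstant * Real.log x * (1 + 1 / Real.log x ^ 2) :=
  eq_3_30_on_gap RosserSchoenfeldEq327.invA_283 RosserSchoenfeldEq320.inv_283 (p' := 293)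
    (fun q hq1 hq2 hq => by interval_cases q; all_goals exact absurd hq (by norm_num)) 32900 (by norm_num) (by norm_num)
    (by exact_mod_cast h1) (by exact_mod_cast h2)

end RosserSchoenfeldEq330

open RosserSchoenfeldEq330

/-! ### Assembly -/

/-- **(3.30) for `1 < x < 286`, UNCONDITIONALLY** (kernel certificate gap by gap; by hand below `5`).
[cite: RosserSchoenfeld1962, Thm. 8 Cor. (3.30), p. 70] -/
theorem RosserSchoenfeld1962_eq_3_30_of_lt_286 {x : ℝ} (hx : 1 < x) (hx' : x < 286) :
    ∏ q ∈ Nat.primesLE ⌊x⌋₊, (q : ℝ) / ((q : ℝ) - 1) <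
      Real.exp Real.eulerMascheroniConstant * Real.log x * (1 + 1 / Real.log x ^ 2) := by
  rcases lt_or_ge x 131 with hA1 | hB1
  · rcases lt_or_ge x 59 with hA2 | hB2
    · rcases lt_or_ge x 23 with hA3 | hB3
      · rcases lt_or_ge x 11 with hA4 | hB4
        · rcases lt_or_ge x 5 with hA5 | hB5
          · exact eq_3_30_of_lt_five hx hA5
          · rcases lt_or_ge x 7 with hA6 | hB6
            · exact gap_5 hB5 hA6
            · exact gap_7 hB6 hA4
        · rcases lt_or_ge x 17 with hA5 | hB5
          · rcases lt_or_ge x 13 with hA6 | hB6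
            · exact gap_11 hB4 hA6
            · exact gap_13 hB6 hA5
          · rcases lt_or_ge x 19 with hA6 | hB6
            · exact gap_17 hB5 hA6
            · exact gap_19 hB6 hA3
      · rcases lt_or_ge x 41 with hA4 | hB4
        · rcases lt_or_ge x 31 with hA5 | hB5
          · rcases lt_or_ge x 29 with hA6 | hB6
            · exact gap_23 hB3 hA6
            · exact gap_29 hB6 hA5
          · rcases lt_or_ge x 37 with hA6 | hB6
            · exact gap_31 hB5 hA6
            · exact gap_37 hB6 hA4
        · rcases lt_or_ge x 47 with hA5 | hB5
          · rcases lt_or_ge x 43 with hA6 | hB6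
            · exact gap_41 hB4 hA6
            · exact gap_43 hB6 hA5
          · rcases lt_or_ge x 53 with hA6 | hB6
            · exact gap_47 hB5 hA6
            · exact gap_53 hB6 hA2
    · rcases lt_or_ge x 89 with hA3 | hB3
      · rcases lt_or_ge x 71 with hA4 | hB4
        · rcases lt_or_ge x 61 with hA5 | hB5
          · exact gap_59 hB2 hA5
          · rcases lt_or_ge x 67 with hA6 | hB6
            · exact gap_61 hB5 hA6
            · exact gap_67 hB6 hA4
        · rcases lt_or_ge x 79 with hA5 | hB5
          · rcases lt_or_ge x 73 with hA6 | hB6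
            · exact gap_71 hB4 hA6
            · exact gap_73 hB6 hA5
          · rcases lt_or_ge x 83 with hA6 | hB6
            · exact gap_79 hB5 hA6
            · exact gap_83 hB6 hA3
      · rcases lt_or_ge x 107 with hA4 | hB4
        · rcases lt_or_ge x 101 with hA5 | hB5
          · rcases lt_or_ge x 97 with hA6 | hB6
            · exact gap_89 hB3 hA6
            · exact gap_97 hB6 hA5
          · rcases lt_or_ge x 103 with hA6 | hB6
            · exact gap_101 hB5 hA6
            · exact gap_103 hB6 hA4
        · rcases lt_or_ge x 113 with hA5 | hB5
          · rcases lt_or_ge x 109 with hA6 | hB6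
            · exact gap_107 hB4 hA6
            · exact gap_109 hB6 hA5
          · rcases lt_or_ge x 127 with hA6 | hB6
            · exact gap_113 hB5 hA6
            · exact gap_127 hB6 hA1
  · rcases lt_or_ge x 211 with hA2 | hB2
    · rcases lt_or_ge x 167 with hA3 | hB3
      · rcases lt_or_ge x 149 with hA4 | hB4
        · rcases lt_or_ge x 137 with hA5 | hB5
          · exact gap_131 hB1 hA5
          · rcases lt_or_ge x 139 with hA6 | hB6
            · exact gap_137 hB5 hA6
            · exact gap_139 hB6 hA4
        · rcases lt_or_ge x 157 with hA5 | hB5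
          · rcases lt_or_ge x 151 with hA6 | hB6
            · exact gap_149 hB4 hA6
            · exact gap_151 hB6 hA5
          · rcases lt_or_ge x 163 with hA6 | hB6
            · exact gap_157 hB5 hA6
            · exact gap_163 hB6 hA3
      · rcases lt_or_ge x 191 with hA4 | hB4
        · rcases lt_or_ge x 179 with hA5 | hB5
          · rcases lt_or_ge x 173 with hA6 | hB6
            · exact gap_167 hB3 hA6
            · exact gap_173 hB6 hA5
          · rcases lt_or_ge x 181 with hA6 | hB6
            · exact gap_179 hB5 hA6
            · exact gap_181 hB6 hA4
        · rcases lt_or_ge x 197 with hA5 | hB5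
          · rcases lt_or_ge x 193 with hA6 | hB6
            · exact gap_191 hB4 hA6
            · exact gap_193 hB6 hA5
          · rcases lt_or_ge x 199 with hA6 | hB6
            · exact gap_197 hB5 hA6
            · exact gap_199 hB6 hA2
    · rcases lt_or_ge x 251 with hA3 | hB3
      · rcases lt_or_ge x 229 with hA4 | hB4
        · rcases lt_or_ge x 223 with hA5 | hB5
          · exact gap_211 hB2 hA5
          · rcases lt_or_ge x 227 with hA6 | hB6
            · exact gap_223 hB5 hA6
            · exact gap_227 hB6 hA4
        · rcases lt_or_ge x 239 with hA5 | hB5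
          · rcases lt_or_ge x 233 with hA6 | hB6
            · exact gap_229 hB4 hA6
            · exact gap_233 hB6 hA5
          · rcases lt_or_ge x 241 with hA6 | hB6
            · exact gap_239 hB5 hA6
            · exact gap_241 hB6 hA3
      · rcases lt_or_ge x 271 with hA4 | hB4
        · rcases lt_or_ge x 263 with hA5 | hB5
          · rcases lt_or_ge x 257 with hA6 | hB6
            · exact gap_251 hB3 hA6
            · exact gap_257 hB6 hA5
          · rcases lt_or_ge x 269 with hA6 | hB6
            · exact gap_263 hB5 hA6
            · exact gap_269 hB6 hA4
        · rcases lt_or_ge x 281 with hA5 | hB5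
          · rcases lt_or_ge x 277 with hA6 | hB6
            · exact gap_271 hB4 hA6
            · exact gap_277 hB6 hA5
          · rcases lt_or_ge x 283 with hA6 | hB6
            · exact gap_281 hB5 hA6
            · exact gap_283 hB6 (by linarith)

/-- **(3.30) for `1 < x < 3 659 203`, UNCONDITIONALLY**: below `286` this file; on `[286, 3 659 203)` the kernel-certified
(3.29) (`RosserSchoenfeld1962_eq_3_29_of_lt_3659203`, factor `1 + 1/(2 log² x) ≤ 1 + 1/log² x`).
[cite: RosserSchoenfeld1962, Thm. 8 (3.29) and Cor. (3.30), p. 70; §8 p. 87] -/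
theorem RosserSchoenfeld1962_eq_3_30_of_lt_3659203 {x : ℝ} (hx : 1 < x) (hx' : x < 3659203) :
    ∏ q ∈ Nat.primesLE ⌊x⌋₊, (q : ℝ) / ((q : ℝ) - 1) <
      Real.exp Real.eulerMascheroniConstant * Real.log x * (1 + 1 / Real.log x ^ 2) := by
  rcases lt_or_ge x 286 with h1 | h1
  · exact RosserSchoenfeld1962_eq_3_30_of_lt_286 hx h1
  · have h29 := RosserSchoenfeld1962_eq_3_29_of_lt_3659203 h1 hx'
    have hlx : 0 < Real.log x := Real.log_pos hx
    have hEL : 0 < Real.exp Real.eulerMascheroniConstant * Real.log x := by positivity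
    have hle : 1 + 1 / (2 * Real.log x ^ 2) ≤ 1 + 1 / Real.log x ^ 2 := by
      have : 1 / (2 * Real.log x ^ 2) ≤ 1 / Real.log x ^ 2 :=
        one_div_le_one_div_of_le (by positivity) (by nlinarith)
      linarith
    exact lt_of_lt_of_le h29 (mul_le_mul_of_nonneg_left hle hEL.le)

/-- **Rosser–Schoenfeld 1962, Corollary (3.30) to Theorem 8, for EVERY real `x > 1`, from Dusart's `θ`-bound alone**:
`∏_{p ≤ x} p/(p − 1) < e^γ log x · (1 + 1/log² x)` (`1 < x < 286`: this file, unconditionally; `x ≥ 286`: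
`RosserSchoenfeld1962_eq_3_30_of_ge_286_holds_of`). [cite: RosserSchoenfeld1962, Thm. 8 Cor. (3.30), p. 70] [cite: Dusart2010, Thm. 5.2 (k = 2)] -/
theorem RosserSchoenfeld1962_eq_3_30_holds_of (h : Dusart2010_theta_thm_5_2) {x : ℝ} (hx : 1 < x) :
    ∏ q ∈ Nat.primesLE ⌊x⌋₊, (q : ℝ) / ((q : ℝ) - 1) <
      Real.exp Real.eulerMascheroniConstant * Real.log x * (1 + 1 / Real.log x ^ 2) := by
  rcases lt_or_ge x 286 with h1 | h1
  · exact RosserSchoenfeld1962_eq_3_30_of_lt_286 hx h1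
  · exact RosserSchoenfeld1962_eq_3_30_of_ge_286_holds_of h h1

/-- **Rosser–Schoenfeld 1962, Theorem 8 with its Corollary, in full, from Dusart's `θ`-bound alone**:
(3.28) (`x > 1`) ∧ (3.29) (`x ≥ 286`) ∧ (3.30) (`x > 1`). [cite: RosserSchoenfeld1962, Thm. 8 (3.28)–(3.29) and Cor. (3.30), p. 70]
[cite: Dusart2010, Thm. 5.2 (k = 2)] -/
theorem RosserSchoenfeld1962_thm8_cor_holds_of (h : Dusart2010_theta_thm_5_2) :
    (∀ x : ℝ, 1 < x →
      Real.exp Real.eulerMascheroniConstant * Real.log x * (1 - 1 / (2 * Real.log x ^ 2)) <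
        ∏ p ∈ Nat.primesLE ⌊x⌋₊, (p : ℝ) / ((p : ℝ) - 1)) ∧
    (∀ x : ℝ, 286 ≤ x →
      ∏ p ∈ Nat.primesLE ⌊x⌋₊, (p : ℝ) / ((p : ℝ) - 1) <
        Real.exp Real.eulerMascheroniConstant * Real.log x * (1 + 1 / (2 * Real.log x ^ 2))) ∧
    (∀ x : ℝ, 1 < x →
      ∏ p ∈ Nat.primesLE ⌊x⌋₊, (p : ℝ) / ((p : ℝ) - 1) <
        Real.exp Real.eulerMascheroniConstant * Real.log x * (1 + 1 / Real.log x ^ 2)) :=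
  ⟨(RosserSchoenfeld1962_thm8_holds_of h).1, (RosserSchoenfeld1962_thm8_holds_of h).2,
    fun _ hx ↦ RosserSchoenfeld1962_eq_3_30_holds_of h hx⟩

end Literature.NumberTheory.LFunctions

end
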